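import Literature.NumberTheory.Rogawski1990.ArchDeltaTransferCentralVanishing          -- ★ the letters' archimedean vocabulary (2-block frame, `archExplicitDelta`, `ArchSmooth`, `quadraticHeckeCharCM`, …)
import Literature.NumberTheory.Weil1964.UnitaryArchSingularTopFormFamily                 -- ★ `archSingularTopFormFamily`
import HarnessLib

/-!
# `K2E4ExplicitArchSingularTransferDefs` — the two ANALYTIC INPUTS of the #9 assembly as DATA STRUCTURES (shapes of record for K2E4-p13 «V1+» and K2E4-p11 «G′-package»)
# (Rogawski 1990 Prop. 8.2.1 (a) at `∞`, pp. 118–119; Lemma 14.5.2 (b) pp. 238–239)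

Track B ∕ K2-LIT, crux h413 = `stmt-HodgeConjecture-24833`; prover seat `hodgecm-mathlib-K2E4-p09` (g0), ASSEMBLER of the XL core (chair ruling R-13a).  DEFINITIONS ONLY (two `structure`s
carrying DATA — a constant and its laws; no `Prop`-valued def, no instance, no notation, no `sorry`); consumer `Theorems/K2E4ExplicitArchSingularTransferOfPackages.lean` takes
`(hH : ∀ … νw z w₁, HStepData L νw z w₁)` and `(hG : ∀ frame data, GPrimeData L α T′ ν e₁ e₂ h₁ h₂)`; the siblings' `∃`-theorems feed them through `Classical.choose`.
* **`HStepData L νw z w₁`** — the H-STEP LAW at the place `w₁` («V1+», K2E4-p13): Harish-Chandra's rank-one limit formula at the centre of `U(1,1)_w₁` for the symmetrised mixed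
  orbital integrals of ★ (E2)'s measure family on the 2-block `∏_w U(diag(½,−½))(L_w)` — ONE constant `C ≠ 0` with
  `∂_ψ[2 sin ψ • Σ_ε ∫ Θ d⊗M(S, u[w₁ ↦ (z e^{iψ}, z e^{−iψ})], ε)] → C • Σ_ε ∫ Θ d⊗M(S ∖ w₁, u, ε)` along `𝓝[≠] 0` (tokens of ★ `ArchEndoscopicCentralDescentValue` §2).
* **`GPrimeData L α T′ ν e₁ e₂ h₁ h₂`** — the G′-PACKAGE on a rational diagonal frame (K2E4-p11): a universal `λ ≠ 0` and, for every smooth `b`, a state family `B` over the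
  2-block data with (reg) `B ∅ u` = the `Δ′`-weighted Haar class sum at the `G`-regular datum `u` (the right side of ★ (β₀)), (step) its one-step law along the central curves
  (filter `𝓝[>] 0`), (end) `B univ u = λ · Φ^{st}_∞(t(e₁,e₂,e₁), b)` against the singular top-form family of `ν`.
HONEST LABEL: HC_CM is proved only modulo the 7 printed citations (2 remaining named inputs: hLiu418 = `stmt-HodgeConjecture-24832`, h413 = `stmt-HodgeConjecture-24833`) until rung 0
closes; these are definitions, they assert nothing.

## References
* [Rogawski1990] J. D. Rogawski, *Automorphic Representations of Unitary Groups in Three Variables*, Ann. of Math. Stud. 123 (1990): §8.2 Prop. 8.2.1 (a) pp. 118–119; §14.5 Lemma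
  14.5.2 (b) pp. 238–239; §4.3 (4.3.1) p. 43.
* [Varadarajan1989] V. S. Varadarajan, *An Introduction to Harmonic Analysis on Semisimple Lie Groups* (1989), §6.4 Thm 22.
-/

set_option autoImplicit false
-- the mandated namespace repeats the single-problem summit's segment (`HodgeConjecture.HodgeConjecture`)
set_option linter.dupNamespace false

noncomputable section

open MeasureTheory Measure NumberField NumberField.InfinitePlace NumberField.mixedEmbedding IsDedekindDomain Filter Topology Set
open Literature.MeasureTheory.Group
open Literature.NumberTheory.Rogawski1990 Literature.NumberTheory.Automorphic Literature.NumberTheory.GaloisRepresentations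
open Literature.AlgebraicGeometry.ShimuraVarieties (unitaryGroup hermForm)
-- `Classical`: the place subtypes indexing `mixedSpace L` are `Fintype` classically
open scoped Matrix MatrixGroups ComplexOrder ContDiff Classical
open scoped Matrix.Norms.Operator

namespace Summit.HodgeConjecture.HodgeConjecture.Cruxes.H413.K2E4ExplicitArchSingularTransferDefs

/-- **THE H-STEP LAW AT ONE PLACE, AS DATA** («V1+»): a constant `C ≠ 0` such that for every smooth `Θ` with `g ↦ Θ ↑↑g` compactly supported, every `S ∋ w₁` and every 2-block datum `u`
regular off `w₁`, `∂_ψ[2 sin ψ • Σ_ε ∫ Θ d⊗M(S, u[w₁ ↦ (z e^{iψ}, z e^{−iψ})], ε)] → C • Σ_ε ∫ Θ d⊗M(S ∖ w₁, u, ε)` along `𝓝[≠] 0` (★ (E2)'s measure family `M`: orbit measures of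
`νw` on `S`, Dirac masses at `diag(z_w, z_w)` off `S`). [cite: Rogawski1990, §8.2 Prop. 8.2.1 (a) p. 119] [cite: Varadarajan1989, §6.4 Thm 22] -/
structure HStepData (L : Type) [Field L] [NumberField L] [IsCMField L]
    [∀ w : {w : InfinitePlace L // IsComplex w}, MeasurableSpace (UnitaryGroup.archLocal L 2 (Matrix.diagonal ![(2 : L)⁻¹, -(2 : L)⁻¹]) w)] [∀ w : {w : InfinitePlace L // IsComplex w}, BorelSpace (UnitaryGroup.archLocal L 2 (Matrix.diagonal ![(2 : L)⁻¹, -(2 : L)⁻¹]) w)]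
    (νw : ∀ w : {w : InfinitePlace L // IsComplex w}, Measure (UnitaryGroup.archLocal L 2 (Matrix.diagonal ![(2 : L)⁻¹, -(2 : L)⁻¹]) w)) (z : {w : InfinitePlace L // IsComplex w} → Circle) (w₁ : {w : InfinitePlace L // IsComplex w}) : Type where
  /-- Harish-Chandra's constant at the place `w₁`. -/
  C : ℝ
  /-- The constant is non-zero. -/
  C_ne_zero : C ≠ 0
  /-- The one-step law along the central curve at `w₁`. -/
  tendsto : ∀ (Θ : Matrix (Fin 2) (Fin 2) (mixedEmbedding.mixedSpace L) → ℂ), ContDiff ℝ (⊤ : ℕ∞) Θ →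
    HasCompactSupport (fun g : UnitaryGroup.arch (↥(maximalRealSubfield L)) L (IsCMField.complexConj L) 2 (Matrix.diagonal ![(2 : L)⁻¹, -(2 : L)⁻¹]) => Θ ((g : GL (Fin 2) (mixedEmbedding.mixedSpace L)) : Matrix (Fin 2) (Fin 2) (mixedEmbedding.mixedSpace L))) →
    ∀ (S : Finset {w : InfinitePlace L // IsComplex w}), w₁ ∈ S → ∀ (u : {w : InfinitePlace L // IsComplex w} → Fin 2 → Circle), (∀ w ∈ S, w ≠ w₁ → u w 0 ≠ u w 1) →
    Tendsto (fun ψ : ℝ => deriv (fun ψ : ℝ => (2 * Real.sin ψ) • ∑ ε : {w : InfinitePlace L // IsComplex w} → Bool,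
        ∫ o, Θ ((((((UnitaryGroup.archPiEquivCM 2 L (Matrix.diagonal ![(2 : L)⁻¹, -(2 : L)⁻¹])).symm o) : UnitaryGroup.arch (↥(maximalRealSubfield L)) L (IsCMField.complexConj L) 2 (Matrix.diagonal ![(2 : L)⁻¹, -(2 : L)⁻¹])) : GL (Fin 2) (mixedEmbedding.mixedSpace L)) :
              Matrix (Fin 2) (Fin 2) (mixedEmbedding.mixedSpace L)))
          ∂(Measure.pi (fun w : {w : InfinitePlace L // IsComplex w} =>
            if w ∈ S then (νw w).map (fun g : UnitaryGroup.archLocal L 2 (Matrix.diagonal ![(2 : L)⁻¹, -(2 : L)⁻¹]) w =>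
              g * ⟨UnitaryGroup.circleDiagonal 2 (if ε w then (Function.update u w₁ ![z w₁ * Circle.exp ψ, z w₁ * Circle.exp (-ψ)]) w ∘ ⇑(Equiv.swap (0 : Fin 2) 1) else (Function.update u w₁ ![z w₁ * Circle.exp ψ, z w₁ * Circle.exp (-ψ)]) w),
                UnitaryGroup.circleDiagonal_mem_archLocal_diagonal L 2 ![(2 : L)⁻¹, -(2 : L)⁻¹] w _⟩ * g⁻¹)
            else Measure.dirac (⟨UnitaryGroup.circleDiagonal 2 ![z w, z w], UnitaryGroup.circleDiagonal_mem_archLocal_diagonal L 2 ![(2 : L)⁻¹, -(2 : L)⁻¹] w _⟩ : UnitaryGroup.archLocal L 2 (Matrix.diagonal ![(2 : L)⁻¹, -(2 : L)⁻¹]) w)))) ψ)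
      (𝓝[≠] 0)
      (𝓝 (C • ∑ ε : {w : InfinitePlace L // IsComplex w} → Bool,
        ∫ o, Θ ((((((UnitaryGroup.archPiEquivCM 2 L (Matrix.diagonal ![(2 : L)⁻¹, -(2 : L)⁻¹])).symm o) : UnitaryGroup.arch (↥(maximalRealSubfield L)) L (IsCMField.complexConj L) 2 (Matrix.diagonal ![(2 : L)⁻¹, -(2 : L)⁻¹])) : GL (Fin 2) (mixedEmbedding.mixedSpace L)) :
              Matrix (Fin 2) (Fin 2) (mixedEmbedding.mixedSpace L)))
          ∂(Measure.pi (fun w : {w : InfinitePlace L // IsComplex w} =>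
            if w ∈ S.erase w₁ then (νw w).map (fun g : UnitaryGroup.archLocal L 2 (Matrix.diagonal ![(2 : L)⁻¹, -(2 : L)⁻¹]) w =>
              g * ⟨UnitaryGroup.circleDiagonal 2 (if ε w then (u) w ∘ ⇑(Equiv.swap (0 : Fin 2) 1) else (u) w),
                UnitaryGroup.circleDiagonal_mem_archLocal_diagonal L 2 ![(2 : L)⁻¹, -(2 : L)⁻¹] w _⟩ * g⁻¹)
            else Measure.dirac (⟨UnitaryGroup.circleDiagonal 2 ![z w, z w], UnitaryGroup.circleDiagonal_mem_archLocal_diagonal L 2 ![(2 : L)⁻¹, -(2 : L)⁻¹] w _⟩ : UnitaryGroup.archLocal L 2 (Matrix.diagonal ![(2 : L)⁻¹, -(2 : L)⁻¹]) w)))))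

/-- **THE G′-PACKAGE ON A RATIONAL DIAGONAL FRAME, AS DATA**: frame `U(diagonal α)_∞`, a transfer factor `T′` (on the explicit ray, a hypothesis of the consumer), a measure `ν`
(Haar), rational `e₁, e₂` with `c(e_i) e_i = 1`; the package is a universal `lam ≠ 0` and, for every smooth `b`, a state family `family b hb` over the 2-block data with (reg) at
`S = ∅` the `Δ′`-weighted Haar class sum at the `H_∞`-point `(Φ_{Q₂}⁻¹ t₂(u), e₂ ⊗ 1)`, (step) the one-step law along `(σe₁ e^{iψ}, σe₁ e^{−iψ})` (filter `𝓝[>] 0`), (end) at `S = univ`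
`lam ·` the unsigned stable sum at the wall torus point `t(e₁, e₂, e₁)` against the singular top-form family of `ν`. [cite: Rogawski1990, §8.2 Prop. 8.2.1 (a) pp. 118–119; §14.5 Lemma 14.5.2 (b) pp. 238–239] -/
structure GPrimeData (L : Type) [Field L] [NumberField L] [IsCMField L] (α : Fin 3 → L)
    [MeasurableSpace (UnitaryGroup.arch (↥(maximalRealSubfield L)) L (IsCMField.complexConj L) 3 (Matrix.diagonal α))] [BorelSpace (UnitaryGroup.arch (↥(maximalRealSubfield L)) L (IsCMField.complexConj L) 3 (Matrix.diagonal α))]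
    [∀ γ : UnitaryGroup.arch (↥(maximalRealSubfield L)) L (IsCMField.complexConj L) 3 (Matrix.diagonal α), MeasurableSpace (UnitaryGroup.arch (↥(maximalRealSubfield L)) L (IsCMField.complexConj L) 3 (Matrix.diagonal α) ⧸ Subgroup.centralizer ({γ} : Set (UnitaryGroup.arch (↥(maximalRealSubfield L)) L (IsCMField.complexConj L) 3 (Matrix.diagonal α))))]
    [∀ γ : UnitaryGroup.arch (↥(maximalRealSubfield L)) L (IsCMField.complexConj L) 3 (Matrix.diagonal α), BorelSpace (UnitaryGroup.arch (↥(maximalRealSubfield L)) L (IsCMField.complexConj L) 3 (Matrix.diagonal α) ⧸ Subgroup.centralizer ({γ} : Set (UnitaryGroup.arch (↥(maximalRealSubfield L)) L (IsCMField.complexConj L) 3 (Matrix.diagonal α))))]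
    (T' : ArchTransferFactor L (Matrix.diagonal α)) (ν : Measure (UnitaryGroup.arch (↥(maximalRealSubfield L)) L (IsCMField.complexConj L) 3 (Matrix.diagonal α))) [IsFiniteMeasureOnCompacts ν] [ν.IsMulRightInvariant]
    (e₁ e₂ : L) (h₁ : (IsCMField.complexConj L e₁ : L) * e₁ = 1) (h₂ : (IsCMField.complexConj L e₂ : L) * e₂ = 1) : Type where
  /-- The universal constant of the fully descended `G′`-state. -/
  lam : ℂ
  /-- It is non-zero. -/
  lam_ne_zero : lam ≠ 0
  /-- The state family of a smooth test function. -/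
  family : ∀ b : UnitaryGroup.arch (↥(maximalRealSubfield L)) L (IsCMField.complexConj L) 3 (Matrix.diagonal α) → ℂ, ArchSmooth L 3 (Matrix.diagonal α) b → Finset {w : InfinitePlace L // IsComplex w} → ({w : InfinitePlace L // IsComplex w} → Fin 2 → Circle) → ℂ
  /-- (reg): at `S = ∅` the state is the `Δ′`-weighted Haar class sum at the `G`-regular datum. -/
  reg : ∀ (b : UnitaryGroup.arch (↥(maximalRealSubfield L)) L (IsCMField.complexConj L) 3 (Matrix.diagonal α) → ℂ) (hb : ArchSmooth L 3 (Matrix.diagonal α) b) (u : {w : InfinitePlace L // IsComplex w} → Fin 2 → Circle),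
    (∀ w, u w 0 ≠ u w 1 ∧ u w 0 ≠ ⟨w.1.embedding e₂, mem_sphere_zero_iff_norm.mpr (UnitaryGroup.norm_embedding_eq_one_of_complexConj_mul_self L e₂ h₂ w)⟩ ∧ u w 1 ≠ ⟨w.1.embedding e₂, mem_sphere_zero_iff_norm.mpr (UnitaryGroup.norm_embedding_eq_one_of_complexConj_mul_self L e₂ h₂ w)⟩) →
    family b hb ∅ u = ∑ᶠ c'' : ConjClasses (UnitaryGroup.arch (↥(maximalRealSubfield L)) L (IsCMField.complexConj L) 3 (Matrix.diagonal α)),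
      T'.Δ ((unitaryGroupOfFormCongrOfEq (UnitaryGroup.conjMixed (↥(maximalRealSubfield L)) L (IsCMField.complexConj L))
              (Matrix.GeneralLinearGroup.map (mixedEmbedding L) (Matrix.GeneralLinearGroup.mkOfDetNeZero !![(1 : L), 1; 1, -1] (UnitaryGroup.det_quasiSplitFrameTwo_ne_zero L)))
              (UnitaryGroup.archFormOf L 2 (Matrix.diagonal ![(2 : L)⁻¹, -(2 : L)⁻¹])) (UnitaryGroup.archFormOf L 2 (Matrix.of fun i j : Fin 2 => if i.val + j.val + 1 = 2 then (1 : L) else 0))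
              (UnitaryGroup.formCongr_map_mixedEmbedding_archFormOf_eq L (UnitaryGroup.formCongr_quasiSplitFrameTwo_diagonal L))).symm
              (UnitaryGroup.archDiagTorus L 2 ![(2 : L)⁻¹, -(2 : L)⁻¹] u),
            (UnitaryGroup.archPiEquivCM 1 L (Matrix.of fun i j : Fin 1 => if i.val + j.val + 1 = 1 then (1 : L) else 0)).symm fun w =>
              ⟨UnitaryGroup.circleDiagonal 1 ![(⟨w.1.embedding e₂, mem_sphere_zero_iff_norm.mpr (UnitaryGroup.norm_embedding_eq_one_of_complexConj_mul_self L e₂ h₂ w)⟩ : Circle)], UnitaryGroup.circleDiagonal_mem_archLocal_antidiagOne L w _⟩)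
          (Quotient.out c'') *
        ∫ g, b (g * Quotient.out c'' * g⁻¹) ∂ν
  /-- (step): the one-step law along the central curve at an unprocessed place. -/
  step : ∀ (b : UnitaryGroup.arch (↥(maximalRealSubfield L)) L (IsCMField.complexConj L) 3 (Matrix.diagonal α) → ℂ) (hb : ArchSmooth L 3 (Matrix.diagonal α) b) (S : Finset {w : InfinitePlace L // IsComplex w}) (w : {w : InfinitePlace L // IsComplex w}), w ∉ S →
    ∀ u : {w : InfinitePlace L // IsComplex w} → Fin 2 → Circle,
      (∀ v, v ∉ S → v ≠ w → u v 0 ≠ u v 1 ∧ u v 0 ≠ ⟨v.1.embedding e₂, mem_sphere_zero_iff_norm.mpr (UnitaryGroup.norm_embedding_eq_one_of_complexConj_mul_self L e₂ h₂ v)⟩ ∧ u v 1 ≠ ⟨v.1.embedding e₂, mem_sphere_zero_iff_norm.mpr (UnitaryGroup.norm_embedding_eq_one_of_complexConj_mul_self L e₂ h₂ v)⟩) →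
      Tendsto (fun ψ : ℝ => deriv (fun ψ : ℝ => (2 * Real.sin ψ) •
          family b hb S (Function.update u w ![⟨w.1.embedding e₁, mem_sphere_zero_iff_norm.mpr (UnitaryGroup.norm_embedding_eq_one_of_complexConj_mul_self L e₁ h₁ w)⟩ * Circle.exp ψ, ⟨w.1.embedding e₁, mem_sphere_zero_iff_norm.mpr (UnitaryGroup.norm_embedding_eq_one_of_complexConj_mul_self L e₁ h₁ w)⟩ * Circle.exp (-ψ)])) ψ)
        (𝓝[>] 0) (𝓝 (family b hb (insert w S) u))
  /-- (end): the fully descended state is `lam ·` the unsigned top-form stable sum at the wall torus point. -/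
  end_eq : ∀ (b : UnitaryGroup.arch (↥(maximalRealSubfield L)) L (IsCMField.complexConj L) 3 (Matrix.diagonal α) → ℂ) (hb : ArchSmooth L 3 (Matrix.diagonal α) b) (u : {w : InfinitePlace L // IsComplex w} → Fin 2 → Circle),
    family b hb Finset.univ u = lam * archStableOrbitalIntegral L 3 (Matrix.diagonal α)
      (Literature.NumberTheory.Weil1964.UnitaryArchTopForm.archSingularTopFormFamily L (Matrix.diagonal α) ν) b
      (UnitaryGroup.archDiagTorus L 3 α fun w => ![(⟨w.1.embedding e₁, mem_sphere_zero_iff_norm.mpr (UnitaryGroup.norm_embedding_eq_one_of_complexConj_mul_self L e₁ h₁ w)⟩ : Circle), ⟨w.1.embedding e₂, mem_sphere_zero_iff_norm.mpr (UnitaryGroup.norm_embedding_eq_one_of_complexConj_mul_self L e₂ h₂ w)⟩, ⟨w.1.embedding e₁, mem_sphere_zero_iff_norm.mpr (UnitaryGroup.norm_embedding_eq_one_of_complexConj_mul_self L e₁ h₁ w)⟩])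

end Summit.HodgeConjecture.HodgeConjecture.Cruxes.H413.K2E4ExplicitArchSingularTransferDefs

end
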